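import Mathlib
import Literature.Analysis.Quadrature.ChebyshevCoefficients
import Literature.Analysis.FunctionSpaces.BVIntegrationByParts
import HarnessLib

/-!
# Chebyshev coefficients when `f^{(k)}` has bounded variation (Trefethen 2008, Thm. 4.2, BV form)

Topic `Literature/Analysis/Quadrature`; PROVED theorems (no named fact).  Companion of
`ChebyshevCoefficients` (`chebCoeff`, `a_j(f) = (2/π) ∫_0^π f(cos θ) cos(jθ) dθ`, Trefethen 2008
(4.4)), which proves [cite: Trefethen2008, Thm. 4.2 (4.6)] for `f^{(k)}` continuous and piecewise
`C¹`.  Here the STIELTJES generality of (4.5)–(4.6) loc. cit. is formalised: `f^{(k)}` merely of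
bounded variation, jumps allowed (e.g. `f = |x - c|`, `k = 1`, `f' = sign(x - c)`), in the form of
Trefethen's later statement (*Approximation Theory and Approximation Practice*, SIAM 2013,
Thm. 7.1: *if `f, …, f^{(ν-1)}` are absolutely continuous on `[-1, 1]` and `f^{(ν)}` has bounded
variation `V`, then `|a_k| ≤ 2V / (π k (k-1) ⋯ (k-ν))` for `k ≥ ν + 1`*), with the PLAIN variation
`V = Var_{[-1,1]} f^{(ν)}` (`≤ ‖f^{(ν)}‖_T` of (4.5) loc. cit.) and with the sharper product
denominator `∏_{i=0}^{ν} (k - ν + 2i) ≥ k (k-1) ⋯ (k-ν)` that the integration-by-parts recursion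
actually yields (the sharpening studied in [Majidian2017]).

## What is formalised

* `norm_chebCoeff_le_of_boundedVariationOn_base`: `|a_j(G)| ≤ 2 Var_{[-1,1]} G / (π j)` for
  `G : [-1, 1] → ℝ` of bounded variation and `j ≥ 1` — one Stieltjes integration by parts
  `∫_0^π G(cos θ) cos(jθ) dθ = -∫_0^π (sin(jθ)/j) d(G∘cos)(θ)`, `|…| ≤ Var_{[0,π]}(G∘cos) / j
  = Var_{[-1,1]} G / j` (`Literature.Analysis.FunctionSpaces.abs_integral_mul_deriv_le_mul_variation`,
  Montgomery–Vaughan App. A).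
* `norm_chebCoeff_le_of_boundedVariationOn`: for a chain `F 0 = f, F 1, …, F m` of real functions
  with `F i` continuous on `[-1, 1]` and `F (i+1)` the derivative of `F i` on `(-1, 1)` off a fixed
  countable set `s` (`i < m`), and `F m` of bounded variation on `[-1, 1]` with `V = Var F m`:
  `|a_j(f)| ≤ (2V/π) / ∏_{i=0}^{m} (j - m + 2i)` for `j ≥ m + 1`
  (induction on `m` via `chebCoeff_eq_of_hasDerivAt`: `a_j(u) = (a_{j-1}(u') - a_{j+1}(u')) / (2j)`;
  the recursion closes exactly on the product).
* `norm_chebCoeff_le_of_boundedVariationOn_descFactorial`: the corollary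
  `|a_j(f)| ≤ (2V/π) / (j (j-1) ⋯ (j-m))` (Thm. 7.1 / (4.6) form, `ν = k = m`).

## References

* L. N. Trefethen, *Is Gauss quadrature better than Clenshaw–Curtis?*, SIAM Review **50** (2008)
  67–87, Thm. 4.2, eqs. (4.4)–(4.6). [cite: Trefethen2008, Thm. 4.2 (4.6)]
* L. N. Trefethen, *Approximation Theory and Approximation Practice*, SIAM 2013, Thm. 7.1
  (the bounded-variation statement).
* H. Majidian, *On the decay rate of Chebyshev coefficients*, Appl. Numer. Math. **113** (2017)
  44–53, doi:10.1016/j.apnum.2016.11.004 (sharpened denominators). [Majidian2017]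
* H. L. Montgomery, R. C. Vaughan, *Multiplicative Number Theory I*, CUP 2007, App. A
  (the Stieltjes integration by parts used in the base case). [MontgomeryVaughan2007]

AI-produced formalisation (H21 engines group, seat eng-quad-3, 2026-08-21); no facts, no axioms
beyond Mathlib's, no `sorry`.
-/

noncomputable section

open Set MeasureTheory Filter intervalIntegral

open scoped Real Interval

namespace Literature.Analysis.Quadrature

open Literature.Analysis.FunctionSpaces

/-! ### The base case: one Stieltjes integration by parts -/

/-- `Var_{[0,π]} (G ∘ cos) ≤ Var_{[-1,1]} G` (`cos` is monotone on `[0, π]`). [folklore] -/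
private theorem eVariationOn_comp_cos_le (G : ℝ → ℝ) :
    eVariationOn (fun θ => G (Real.cos θ)) (Icc 0 π) ≤ eVariationOn G (Icc (-1 : ℝ) 1) :=
  eVariationOn.comp_le_of_antitoneOn G Real.cos Real.antitoneOn_cos (Real.mapsTo_cos _)

/-- For `G` of bounded variation on `[-1, 1]`, `θ ↦ G(cos θ)` (as a complex function) is
integrable on `[0, π]` (difference of two monotone functions). [folklore] -/
private theorem intervalIntegrable_comp_cos_of_boundedVariationOn {G : ℝ → ℝ}
    (hG : BoundedVariationOn G (Icc (-1 : ℝ) 1)) :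
    IntervalIntegrable (fun θ : ℝ => (G (Real.cos θ) : ℂ)) volume 0 π := by
  have hB : BoundedVariationOn (fun θ => G (Real.cos θ)) (Icc 0 π) :=
    ne_top_of_le_ne_top hG (eVariationOn_comp_cos_le G)
  obtain ⟨p, q, hp, hq, hpq, -⟩ :=
    hB.locallyBoundedVariationOn.exists_monotoneOn_sub_monotoneOn'
  have hreal : IntervalIntegrable (fun θ => G (Real.cos θ)) volume 0 π := by
    rw [hpq]
    exact (MonotoneOn.intervalIntegrable (by rwa [uIcc_of_le Real.pi_pos.le])).sub
      (MonotoneOn.intervalIntegrable (by rwa [uIcc_of_le Real.pi_pos.le]))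
  rw [intervalIntegrable_iff] at hreal ⊢
  exact hreal.ofReal

/-- **Base case** (`ν = 0` of ATAP Thm. 7.1; the Stieltjes step behind Trefethen 2008 (4.6)):
if `G : [-1, 1] → ℝ` has bounded variation `V = Var_{[-1,1]} G`, then for `j ≥ 1`
`|a_j(G)| ≤ 2V / (π j)`.  Proof: `∫_0^π G(cos θ) cos(jθ) dθ = [G(cos θ) sin(jθ)/j]_0^π
- ∫_0^π (sin(jθ)/j) d(G∘cos)`, the bracket vanishes, `|sin(jθ)/j| ≤ 1/j` and
`Var_{[0,π]} (G∘cos) ≤ V`. [cite: Trefethen2008, Thm. 4.2 (4.6)] -/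
theorem norm_chebCoeff_le_of_boundedVariationOn_base {G : ℝ → ℝ}
    (hG : BoundedVariationOn G (Icc (-1 : ℝ) 1)) {j : ℕ} (hj : 1 ≤ j) :
    ‖chebCoeff (fun x => (G x : ℂ)) j‖ ≤
      2 / π * (eVariationOn G (Icc (-1 : ℝ) 1)).toReal / j := by
  have hπ : (0 : ℝ) < π := Real.pi_pos
  have hj0 : (0 : ℝ) < j := by exact_mod_cast hj
  set H : ℝ → ℝ := fun θ => G (Real.cos θ) with hH
  have hHB : BoundedVariationOn H (Icc 0 π) := ne_top_of_le_ne_top hG (eVariationOn_comp_cos_le G)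
  -- `Φ = sin(j·)/j`, `ψ = cos(j·)`
  have hΦ : ∀ θ ∈ Icc (0 : ℝ) π,
      HasDerivAt (fun θ : ℝ => Real.sin (j * θ) / j) (Real.cos (j * θ)) θ := by
    intro θ _
    have h1 : HasDerivAt (fun θ : ℝ => Real.sin (j * θ)) (Real.cos (j * θ) * (j * 1)) θ :=
      ((hasDerivAt_id' θ).const_mul (j : ℝ)).sin
    refine (h1.div_const (j : ℝ)).congr_deriv ?_
    rw [mul_one, mul_div_assoc, div_self hj0.ne', mul_one]
  have hψ : ContinuousOn (fun θ : ℝ => Real.cos (j * θ)) (Icc 0 π) :=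
    (by fun_prop : Continuous fun θ : ℝ => Real.cos (j * θ)).continuousOn
  have hM : ∀ θ ∈ Icc (0 : ℝ) π, |Real.sin (j * θ) / j| ≤ 1 / j := by
    intro θ _
    rw [abs_div, abs_of_pos hj0]
    exact div_le_div_of_nonneg_right (Real.abs_sin_le_one _) hj0.le
  have h0 : Real.sin (j * (0 : ℝ)) / j = 0 := by simp
  have hπ' : Real.sin (j * π) / j = 0 := by rw [Real.sin_nat_mul_pi, zero_div]
  have hI := abs_integral_mul_deriv_le_mul_variation hπ.le hHB hΦ hψ hM h0 hπ'
  have hV : (eVariationOn H (Icc 0 π)).toReal ≤ (eVariationOn G (Icc (-1 : ℝ) 1)).toReal :=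
    ENNReal.toReal_mono hG (eVariationOn_comp_cos_le G)
  -- the integral defining `a_j` is the real integral `∫_0^π H cos(j·)`
  have hint : (∫ θ in (0 : ℝ)..π, ((G (Real.cos θ) : ℝ) : ℂ) * (Real.cos (j * θ) : ℂ)) =
      ((∫ θ in (0 : ℝ)..π, H θ * Real.cos (j * θ) : ℝ) : ℂ) := by
    rw [← intervalIntegral.integral_ofReal]
    push_cast
    rfl
  have hn : ‖(2 / π : ℂ)‖ = 2 / π := by
    rw [show (2 / π : ℂ) = ((2 / π : ℝ) : ℂ) by push_cast; rfl, Complex.norm_real,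
      Real.norm_of_nonneg (by positivity)]
  rw [chebCoeff, hint, norm_mul, hn, Complex.norm_real, Real.norm_eq_abs, mul_div_assoc]
  refine mul_le_mul_of_nonneg_left ?_ (by positivity)
  calc |∫ θ in (0 : ℝ)..π, H θ * Real.cos (j * θ)|
      ≤ 1 / j * (eVariationOn H (Icc 0 π)).toReal := hI
    _ ≤ 1 / j * (eVariationOn G (Icc (-1 : ℝ) 1)).toReal :=
        mul_le_mul_of_nonneg_left hV (by positivity)
    _ = (eVariationOn G (Icc (-1 : ℝ) 1)).toReal / j := by ring

/-! ### The recursion: `m` integrations by parts -/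

/-- **Chebyshev coefficients of a function whose `m`-th derivative has bounded variation**
(Trefethen 2008 Thm. 4.2 (4.6) in the Stieltjes generality of (4.5) = ATAP Thm. 7.1, sharpened
denominators): for a chain `F 0 = f, F 1, …, F m : [-1, 1] → ℝ` with `F i` continuous on `[-1, 1]`
and `F (i+1)` the derivative of `F i` at every point of `(-1, 1)` off a countable set `s`
(`i < m`), and `F m` of bounded variation on `[-1, 1]`, `V = Var_{[-1,1]} F m`:
for every `j ≥ m + 1`, `|a_j(f)| ≤ (2V/π) / ∏_{i=0}^{m} (j - m + 2i)`
(`m = 0`: `2V/(πj)`; `m = 1`: `2V/(π (j-1)(j+1))`; `m = 2`: `2V/(π (j-2) j (j+2))`; …).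
Since `∏_{i=0}^{m} (j - m + 2i) ≥ j (j-1) ⋯ (j-m)` and `V ≤ ‖F m‖_T`, this implies (4.6) loc. cit.
with `k = m`.  Jumps of `F m` are allowed (`f = |x|`: `m = 1`, `F 1 = sign`, `V = 2`,
`|a_j| ≤ 4 / (π (j² - 1))`, attained for `j ≡ 2 (mod 4)`). [cite: Trefethen2008, Thm. 4.2 (4.6)] -/
theorem norm_chebCoeff_le_of_boundedVariationOn {s : Set ℝ} (hs : s.Countable) :
    ∀ (m : ℕ) {F : ℕ → ℝ → ℝ},
      (∀ i < m, ContinuousOn (F i) (Icc (-1 : ℝ) 1)) →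
      (∀ i < m, ∀ x ∈ Ioo (-1 : ℝ) 1 \ s, HasDerivAt (F i) (F (i + 1) x) x) →
      BoundedVariationOn (F m) (Icc (-1 : ℝ) 1) →
      ∀ {j : ℕ}, m + 1 ≤ j →
        ‖chebCoeff (fun x => (F 0 x : ℂ)) j‖ ≤
          (2 / π * (eVariationOn (F m) (Icc (-1 : ℝ) 1)).toReal) /
            ∏ i ∈ Finset.range (m + 1), ((j : ℝ) - m + 2 * i)
  | 0, F, _, _, hBV, j, hj => by
    rw [Finset.prod_range_one]
    simp only [CharP.cast_eq_zero, sub_zero, mul_zero, add_zero]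
    exact norm_chebCoeff_le_of_boundedVariationOn_base hBV (by omega)
  | m + 1, F, hcont, hder, hBV, j, hj => by
    have hπ : (0 : ℝ) < π := Real.pi_pos
    -- `θ ↦ F 1 (cos θ)` is integrable on `[0, π]` (continuous if `m ≥ 1`, of bounded variation if
    -- `m = 0`)
    have hi1 : IntervalIntegrable (fun θ : ℝ => (F 1 (Real.cos θ) : ℂ)) volume 0 π := by
      rcases Nat.eq_zero_or_pos m with hm0 | hm0
      · subst hm0
        exact intervalIntegrable_comp_cos_of_boundedVariationOn hBV
      · have hc : ContinuousOn (F 1) (Icc (-1 : ℝ) 1) := hcont 1 (by omega)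
        have hc' : Continuous fun θ : ℝ => (F 1 (Real.cos θ) : ℂ) :=
          Complex.continuous_ofReal.comp
            (hc.comp_continuous Real.continuous_cos Real.cos_mem_Icc)
        exact hc'.intervalIntegrable _ _
    -- one integration by parts
    have hstep := chebCoeff_eq_of_hasDerivAt hs (u := fun x => (F 0 x : ℂ))
      (u' := fun x => (F 1 x : ℂ))
      (Complex.continuous_ofReal.comp_continuousOn (hcont 0 (by omega)))
      (fun x hx => (hder 0 (by omega) x hx).ofReal_comp) hi1 (m := j) (by omega)
    -- the induction hypothesis for the shifted chain `F 1, F 2, …`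
    have ih := fun {j : ℕ} (hj : m + 1 ≤ j) =>
      norm_chebCoeff_le_of_boundedVariationOn hs m (F := fun i => F (i + 1))
        (fun i hi => hcont (i + 1) (by omega)) (fun i hi => hder (i + 1) (by omega)) hBV hj
    set W : ℝ := 2 / π * (eVariationOn (F (m + 1)) (Icc (-1 : ℝ) 1)).toReal with hW
    have hW0 : 0 ≤ W := mul_nonneg (by positivity) ENNReal.toReal_nonneg
    -- the three products
    set A : ℝ := ∏ i ∈ Finset.range (m + 1), ((j : ℝ) - 1 - m + 2 * i) with hA
    set B : ℝ := ∏ i ∈ Finset.range (m + 1), ((j : ℝ) + 1 - m + 2 * i) with hB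
    have hj1 : 1 ≤ j := by omega
    have hmj : (m : ℝ) + 2 ≤ j := by exact_mod_cast (show m + 2 ≤ j by omega)
    have hA0 : 0 < A := Finset.prod_pos fun i _ => by
      have : (0 : ℝ) ≤ i := Nat.cast_nonneg i
      linarith
    have hB0 : 0 < B := Finset.prod_pos fun i _ => by
      have : (0 : ℝ) ≤ i := Nat.cast_nonneg i
      linarith
    have h1 : ‖chebCoeff (fun x => (F 1 x : ℂ)) (j - 1)‖ ≤ W / A := by
      have h := ih (j := j - 1) (by omega)
      have hcast : (∏ i ∈ Finset.range (m + 1), (((j - 1 : ℕ) : ℝ) - m + 2 * i)) = A := by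
        refine Finset.prod_congr rfl fun i _ => ?_
        rw [Nat.cast_sub hj1, Nat.cast_one]
      rwa [hcast] at h
    have h2 : ‖chebCoeff (fun x => (F 1 x : ℂ)) (j + 1)‖ ≤ W / B := by
      have h := ih (j := j + 1) (by omega)
      have hcast : (∏ i ∈ Finset.range (m + 1), (((j + 1 : ℕ) : ℝ) - m + 2 * i)) = B := by
        refine Finset.prod_congr rfl fun i _ => ?_
        push_cast
        ring
      rwa [hcast] at h
    -- the new product `P = (j - m - 1) B = A (j + m + 1)`
    have hP1 : (∏ i ∈ Finset.range (m + 1 + 1), ((j : ℝ) - (m + 1 : ℕ) + 2 * i)) =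
        ((j : ℝ) - m - 1) * B := by
      rw [Finset.prod_range_succ', mul_comm]
      congr 1
      · push_cast
        ring
      · refine Finset.prod_congr rfl fun i _ => ?_
        push_cast
        ring
    have hP2 : (∏ i ∈ Finset.range (m + 1 + 1), ((j : ℝ) - (m + 1 : ℕ) + 2 * i)) =
        A * ((j : ℝ) + m + 1) := by
      rw [Finset.prod_range_succ]
      congr 1
      · refine Finset.prod_congr rfl fun i _ => ?_
        push_cast
        ring
      · push_cast
        ring
    have hP0 : 0 < ((j : ℝ) - m - 1) * B := mul_pos (by linarith) hB0
    have hj0 : (0 : ℝ) < j := by exact_mod_cast (show 0 < j by omega)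
    have hn : ‖(2 * j : ℂ)‖ = 2 * j := by
      rw [show (2 * j : ℂ) = ((2 * j : ℝ) : ℂ) by push_cast; rfl, Complex.norm_real,
        Real.norm_of_nonneg (by positivity)]
    -- `(1/A + 1/B) P = 2j` for `P = (j - m - 1) B = A (j + m + 1)`
    have hAB : A * ((j : ℝ) + m + 1) = ((j : ℝ) - m - 1) * B := by rw [← hP2, hP1]
    have hq : ((j : ℝ) - m - 1) * B / A = (j : ℝ) + m + 1 := by
      rw [div_eq_iff hA0.ne', ← hAB]
      ring
    have hfinal : (W / A + W / B) * (((j : ℝ) - m - 1) * B) = W * (2 * j) := by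
      calc (W / A + W / B) * (((j : ℝ) - m - 1) * B)
          = W * (((j : ℝ) - m - 1) * B / A) + W * ((j : ℝ) - m - 1) * (B / B) := by ring
        _ = W * ((j : ℝ) + m + 1) + W * ((j : ℝ) - m - 1) := by
            rw [hq, div_self hB0.ne', mul_one]
        _ = W * (2 * j) := by ring
    rw [hP1, hstep, norm_div, hn, div_le_div_iff₀ (by positivity) hP0]
    calc ‖chebCoeff (fun x => (F 1 x : ℂ)) (j - 1) - chebCoeff (fun x => (F 1 x : ℂ)) (j + 1)‖ *
          (((j : ℝ) - m - 1) * B)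
        ≤ (W / A + W / B) * (((j : ℝ) - m - 1) * B) :=
          mul_le_mul_of_nonneg_right ((norm_sub_le _ _).trans (add_le_add h1 h2)) hP0.le
      _ = W * (2 * j) := hfinal

/-! ### The descending-factorial form -/

/-- `j (j-1) ⋯ (j-m) ≤ ∏_{i=0}^{m} (j - m + 2i)` for `j ≥ m + 1`. [folklore] -/
private theorem descFactorial_le_prod {m j : ℕ} (hj : m + 1 ≤ j) :
    (j.descFactorial (m + 1) : ℝ) ≤ ∏ i ∈ Finset.range (m + 1), ((j : ℝ) - m + 2 * i) := by
  induction m with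
  | zero =>
    simp
  | succ m ih =>
    have ih' := ih (by omega)
    have hmj : (m : ℝ) + 2 ≤ j := by exact_mod_cast (show m + 2 ≤ j by omega)
    rw [Nat.descFactorial_succ, Nat.cast_mul, Nat.cast_sub (by omega), Finset.prod_range_succ']
    have hfac : (0 : ℝ) ≤ (j : ℝ) - ((m + 1 : ℕ) : ℝ) := by
      push_cast
      linarith
    have hprod : (∏ i ∈ Finset.range (m + 1), ((j : ℝ) - m + 2 * i)) ≤
        ∏ i ∈ Finset.range (m + 1), ((j : ℝ) - ((m + 1 : ℕ) : ℝ) + 2 * ((i + 1 : ℕ) : ℝ)) := by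
      refine Finset.prod_le_prod (fun i _ => ?_) fun i _ => ?_
      · have : (0 : ℝ) ≤ i := Nat.cast_nonneg i
        linarith
      · push_cast
        linarith
    calc ((j : ℝ) - ((m + 1 : ℕ) : ℝ)) * (j.descFactorial (m + 1) : ℝ)
        ≤ ((j : ℝ) - ((m + 1 : ℕ) : ℝ)) * ∏ i ∈ Finset.range (m + 1), ((j : ℝ) - m + 2 * i) :=
          mul_le_mul_of_nonneg_left ih' hfac
      _ ≤ ((j : ℝ) - ((m + 1 : ℕ) : ℝ)) *
            ∏ i ∈ Finset.range (m + 1), ((j : ℝ) - ((m + 1 : ℕ) : ℝ) + 2 * ((i + 1 : ℕ) : ℝ)) :=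
          mul_le_mul_of_nonneg_left hprod hfac
      _ = (∏ i ∈ Finset.range (m + 1), ((j : ℝ) - ((m + 1 : ℕ) : ℝ) + 2 * ((i + 1 : ℕ) : ℝ))) *
            ((j : ℝ) - ((m + 1 : ℕ) : ℝ) + 2 * ((0 : ℕ) : ℝ)) := by
          push_cast
          ring

/-- **Trefethen 2008 Thm. 4.2 (4.6) / ATAP Thm. 7.1, bounded-variation form**: under the
hypotheses of `norm_chebCoeff_le_of_boundedVariationOn` (`F m` of bounded variation `V` on
`[-1, 1]`, jumps allowed), for `j ≥ m + 1`: `|a_j(f)| ≤ (2V/π) / (j (j-1) ⋯ (j-m))`.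
[cite: Trefethen2008, Thm. 4.2 (4.6)] -/
theorem norm_chebCoeff_le_of_boundedVariationOn_descFactorial {s : Set ℝ} (hs : s.Countable)
    (m : ℕ) {F : ℕ → ℝ → ℝ} (hcont : ∀ i < m, ContinuousOn (F i) (Icc (-1 : ℝ) 1))
    (hder : ∀ i < m, ∀ x ∈ Ioo (-1 : ℝ) 1 \ s, HasDerivAt (F i) (F (i + 1) x) x)
    (hBV : BoundedVariationOn (F m) (Icc (-1 : ℝ) 1)) {j : ℕ} (hj : m + 1 ≤ j) :
    ‖chebCoeff (fun x => (F 0 x : ℂ)) j‖ ≤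
      (2 / π * (eVariationOn (F m) (Icc (-1 : ℝ) 1)).toReal) / (j.descFactorial (m + 1) : ℝ) := by
  have h := norm_chebCoeff_le_of_boundedVariationOn hs m hcont hder hBV hj
  have hpos : (0 : ℝ) < (j.descFactorial (m + 1) : ℝ) := by
    exact_mod_cast Nat.descFactorial_pos.mpr (by omega)
  exact h.trans (div_le_div_of_nonneg_left (mul_nonneg (by positivity) ENNReal.toReal_nonneg)
    hpos (descFactorial_le_prod hj))

end Literature.Analysis.Quadrature

end
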